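import Summits.Ventures.KdS.RouteW
import HarnessLib

/-!
# Venture KdS — ROUTE W: the gauge glue `K_G` PROVED (`RouteW.GaugeGlue`)

HONEST FRAMING (venture `Summits/Ventures/KdS`, cell `pub-kds`): this file discharges ONE of the
five named hypotheses of `RouteW.prop38_of_routeW` — the elementary one, `RouteW.GaugeGlue`:
Euler-gauge Heun mode data `u` on `(1,z₂)` (Umetsu form with parameters
`(γ,δ,ε;α,β;q) = eulerGauge…(m₁,m₂,m₃,m₄; E)`) gives, under
`R = z^{γ/2}(z−1)^{δ/2}(z₂−z)^{ε/2}·u` (positive real bases on `(1,z₂)`), normal-form mode data for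
CTdC's (3.11) coefficient `sqcdCoeff m₁ m₂ m₃ m₄ E z₂` with the shifted branch exponents
`ρ + δ/2` at `z = 1` and `ε/2` at `z = z₂`, and `R ≡ 0 ⇒ u ≡ 0`. Ingredients: the product rule, the
kernel-profile calculus of `GeneralHeun.eulerKernel`, and the landed identity
`KerrDeSitter.sqcdCoeff_eq_normalForm` ((3.11) = Heun normal form). Nothing about Kerr–de Sitter
modes is claimed; H1′/H3 stay cited; the other four route-W hypotheses are untouched.

Reference: Casals–Teixeira da Costa, arXiv:2105.13329, (3.11), Lemma 3.5 (3.16), proof of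
Prop. 3.9 (the gauge functions `g_±`).
-/

noncomputable section

open Set Complex

namespace Summit.Ventures.KdS

namespace RouteW

open Literature.Analysis.ODE Literature.Analysis.ODE.GeneralHeun
open Literature.Geometry.Lorentzian Literature.Geometry.Lorentzian.KerrDeSitter

/-! ### Calculus of the kernel profile `k_η(x) = x^{−η}` (`x > 0`) -/

/-- `k_a · k_b = k_{a+b}`. -/
theorem eulerKernel_mul (a b : ℂ) (x : ℝ) :
    eulerKernel a x * eulerKernel b x = eulerKernel (a + b) x := by
  unfold eulerKernel
  rw [← Complex.exp_add]
  ring_nf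

/-- `k_{−c}(x)·x^ρ = x^{ρ+c}` for `x > 0` (principal powers of a positive real). -/
theorem eulerKernel_neg_mul_cpow (c ρ : ℂ) {x : ℝ} (hx : 0 < x) :
    eulerKernel (-c) x * (x : ℂ) ^ ρ = (x : ℂ) ^ (ρ + c) := by
  rw [eulerKernel_eq_cpow (-c) hx, neg_neg, ← Complex.cpow_add _ _ (by exact_mod_cast hx.ne')]
  ring_nf

/-- `k_{−c}(x) = x^{c}` for `x > 0`. -/
theorem eulerKernel_neg_eq_cpow (c : ℂ) {x : ℝ} (hx : 0 < x) :
    eulerKernel (-c) x = (x : ℂ) ^ c := by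
  rw [eulerKernel_eq_cpow (-c) hx, neg_neg]

/-- `k_η' = k_η · (−η/x)` for `x > 0`. -/
theorem hasDerivAt_eulerKernel_mul_inv (η : ℂ) {x : ℝ} (hx : 0 < x) :
    HasDerivAt (eulerKernel η) (eulerKernel η x * (-η * ((x : ℂ))⁻¹)) x := by
  have h := hasDerivAt_eulerKernel η hx
  have hs := mul_eulerKernel_succ η hx
  have hx' : (x : ℂ) ≠ 0 := by exact_mod_cast hx.ne'
  refine h.congr_deriv ?_
  rw [← hs]
  field_simp

/-- `k_η` is `C^∞` on `(0, ∞)`. -/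
theorem contDiffOn_eulerKernel (η : ℂ) :
    ContDiffOn ℝ ((⊤ : ℕ∞) : WithTop ℕ∞) (eulerKernel η) (Ioi 0) := by
  have hlog : ContDiffOn ℝ ((⊤ : ℕ∞) : WithTop ℕ∞) (fun u : ℝ => (Real.log u : ℂ)) (Ioi 0) := by
    have h1 : ContDiffOn ℝ ((⊤ : ℕ∞) : WithTop ℕ∞) Real.log (Ioi 0) :=
      Real.contDiffOn_log.mono (fun x hx => ne_of_gt hx)
    exact (Complex.ofRealCLM.contDiff.comp_contDiffOn h1)
  have h2 : ContDiffOn ℝ ((⊤ : ℕ∞) : WithTop ℕ∞) (fun u : ℝ => -η * (Real.log u : ℂ)) (Ioi 0) :=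
    contDiffOn_const.mul hlog
  exact Complex.contDiff_exp.comp_contDiffOn h2

/-- `z ↦ k_η(z)` is `C^∞` on any set of positive reals. -/
theorem contDiffOn_eulerKernel_of_pos (η : ℂ) {S : Set ℝ} (hS : ∀ z ∈ S, 0 < z) :
    ContDiffOn ℝ ((⊤ : ℕ∞) : WithTop ℕ∞) (fun z : ℝ => eulerKernel η z) S :=
  (contDiffOn_eulerKernel η).mono hS

/-- `z ↦ k_η(z − 1)` is `C^∞` where `z > 1`... more generally on any set where `z − 1 > 0`. -/
theorem contDiffOn_eulerKernel_sub (η : ℂ) (c : ℝ) {S : Set ℝ} (hS : ∀ z ∈ S, 0 < z - c) :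
    ContDiffOn ℝ ((⊤ : ℕ∞) : WithTop ℕ∞) (fun z : ℝ => eulerKernel η (z - c)) S :=
  (contDiffOn_eulerKernel η).comp (contDiffOn_id.sub contDiffOn_const) (fun z hz => hS z hz)

/-- `z ↦ k_η(z₂ − z)` is `C^∞` on any set where `z₂ − z > 0`. -/
theorem contDiffOn_eulerKernel_const_sub (η : ℂ) (c : ℝ) {S : Set ℝ} (hS : ∀ z ∈ S, 0 < c - z) :
    ContDiffOn ℝ ((⊤ : ℕ∞) : WithTop ℕ∞) (fun z : ℝ => eulerKernel η (c - z)) S :=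
  (contDiffOn_eulerKernel η).comp (contDiffOn_const.sub contDiffOn_id) (fun z hz => hS z hz)

/-! ### The gauge weight `W = z^{γ/2}(z−1)^{δ/2}(z₂−z)^{ε/2}` and its derivative -/

/-- The gauge weight `W(z) = z^{γ/2}(z−1)^{δ/2}(z₂−z)^{ε/2}` on `(1,z₂)`, written with `eulerKernel`. -/
def gaugeW (z₂ : ℝ) (γ δ ε : ℂ) (z : ℝ) : ℂ :=
  eulerKernel (-(γ / 2)) z * eulerKernel (-(δ / 2)) (z - 1) * eulerKernel (-(ε / 2)) (z₂ - z)

/-- Half the logarithmic derivative: `P = W′/W = γ/(2z) + δ/(2(z−1)) + ε/(2(z−z₂))` (`= p/2`). -/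
def gaugeP (z₂ : ℝ) (γ δ ε : ℂ) (z : ℝ) : ℂ :=
  γ / 2 * ((z : ℂ))⁻¹ + δ / 2 * ((z : ℂ) - 1)⁻¹ + ε / 2 * ((z : ℂ) - z₂)⁻¹

/-- `P′ = −γ/(2z²) − δ/(2(z−1)²) − ε/(2(z−z₂)²)`. -/
def gaugeP' (z₂ : ℝ) (γ δ ε : ℂ) (z : ℝ) : ℂ :=
  -(γ / 2) * (((z : ℂ))⁻¹) ^ 2 - δ / 2 * (((z : ℂ) - 1)⁻¹) ^ 2 - ε / 2 * (((z : ℂ) - z₂)⁻¹) ^ 2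

/-- `W` never vanishes. -/
theorem gaugeW_ne_zero (z₂ : ℝ) (γ δ ε : ℂ) (z : ℝ) : gaugeW z₂ γ δ ε z ≠ 0 := by
  unfold gaugeW
  exact mul_ne_zero (mul_ne_zero (eulerKernel_ne_zero _ _) (eulerKernel_ne_zero _ _))
    (eulerKernel_ne_zero _ _)

/-- The real map `z ↦ (z − c)⁻¹` cast to `ℂ` has derivative `−((z−c)⁻¹)²`. -/
theorem hasDerivAt_inv_sub_cast (c : ℝ) {z : ℝ} (hz : z - c ≠ 0) :
    HasDerivAt (fun x : ℝ => ((x : ℂ) - c)⁻¹) (-((((z : ℂ) - c)⁻¹) ^ 2)) z := by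
  have h1 : HasDerivAt (fun x : ℝ => (x - c)⁻¹) (-((z - c) ^ 2)⁻¹) z :=
    (hasDerivAt_inv hz).comp_sub_const z c
  have h2 := h1.ofReal_comp
  have hz' : (z : ℂ) - c ≠ 0 := by exact_mod_cast hz
  have e1 : (fun x : ℝ => (((x - c)⁻¹ : ℝ) : ℂ)) = fun x : ℝ => ((x : ℂ) - c)⁻¹ := by
    funext x; push_cast; ring
  rw [e1] at h2
  refine h2.congr_deriv ?_
  push_cast
  field_simp

/-- `W′ = W·P` on `(1, z₂)`. -/
theorem hasDerivAt_gaugeW {z₂ : ℝ} (γ δ ε : ℂ) {z : ℝ} (h1 : 1 < z) (h2 : z < z₂) :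
    HasDerivAt (gaugeW z₂ γ δ ε) (gaugeW z₂ γ δ ε z * gaugeP z₂ γ δ ε z) z := by
  have hz0 : 0 < z := by linarith
  have hz1 : 0 < z - 1 := by linarith
  have hz2 : 0 < z₂ - z := by linarith
  have hA := hasDerivAt_eulerKernel_mul_inv (-(γ / 2)) hz0
  have hB : HasDerivAt (fun x : ℝ => eulerKernel (-(δ / 2)) (x - 1))
      (eulerKernel (-(δ / 2)) (z - 1) * (-(-(δ / 2)) * (((z - 1 : ℝ) : ℂ))⁻¹)) z :=
    (hasDerivAt_eulerKernel_mul_inv (-(δ / 2)) hz1).comp_sub_const z 1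
  have hC : HasDerivAt (fun x : ℝ => eulerKernel (-(ε / 2)) (z₂ - x))
      (-(eulerKernel (-(ε / 2)) (z₂ - z) * (-(-(ε / 2)) * (((z₂ - z : ℝ) : ℂ))⁻¹))) z :=
    (hasDerivAt_eulerKernel_mul_inv (-(ε / 2)) hz2).comp_const_sub z₂ z
  have h := (hA.mul hB).mul hC
  unfold gaugeW gaugeP
  refine h.congr_deriv ?_
  simp only [Pi.mul_apply]
  have hz0' : (z : ℂ) ≠ 0 := by exact_mod_cast hz0.ne'
  have hz1' : (z : ℂ) - 1 ≠ 0 := by exact_mod_cast hz1.ne'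
  have hz2' : (z : ℂ) - z₂ ≠ 0 := by
    have : ((z₂ - z : ℝ) : ℂ) ≠ 0 := by exact_mod_cast hz2.ne'
    intro hc; apply this; push_cast; linear_combination -hc
  have hz2'' : ((z₂ : ℂ) - z) ≠ 0 := fun hc => hz2' (by linear_combination -hc)
  push_cast
  field_simp
  ring

/-- `P′` is the derivative of `P` on `(1,z₂)`. -/
theorem hasDerivAt_gaugeP {z₂ : ℝ} (γ δ ε : ℂ) {z : ℝ} (h1 : 1 < z) (h2 : z < z₂) :
    HasDerivAt (gaugeP z₂ γ δ ε) (gaugeP' z₂ γ δ ε z) z := by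
  have hz0 : z - 0 ≠ 0 := by simp; linarith
  have hz1 : z - 1 ≠ 0 := by linarith
  have hz2 : z - z₂ ≠ 0 := by linarith
  have hA := hasDerivAt_inv_sub_cast 0 hz0
  have hB := hasDerivAt_inv_sub_cast 1 hz1
  have hC := hasDerivAt_inv_sub_cast z₂ hz2
  have h := ((hA.const_mul (γ / 2)).add (hB.const_mul (δ / 2))).add (hC.const_mul (ε / 2))
  unfold gaugeP gaugeP'
  simp only [Complex.ofReal_zero, sub_zero, Complex.ofReal_one] at h ⊢
  refine h.congr_deriv ?_
  ring

/-! ### The theorem -/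

/-- **`K_G` holds**: the Euler-gauge ⇒ normal-form glue of route W, for arbitrary masses.
`R := W·u` with `W = z^{γ/2}(z−1)^{δ/2}(z₂−z)^{ε/2}`; the ODE for `R` is `lead·R″ + sqcdCoeff·R = 0`
by `sqcdCoeff_eq_normalForm`, the branch exponents shift by `δ/2` and `ε/2`, and `W ≠ 0` gives the
injectivity. -/
theorem gaugeGlue_holds : GaugeGlue := by
  intro z₂ m₁ m₂ m₃ m₄ E ρ u hz₂ hu
  obtain ⟨⟨u₁, u₂, hode⟩, ⟨e, he, h, hh, hbr⟩, ⟨e', he', g, hg, hsm⟩⟩ := hu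
  -- parameters
  set γ := eulerGaugeγ m₁ m₂ with hγ
  set δ := eulerGaugeδ m₁ m₂ with hδ
  set ε := eulerGaugeε m₃ m₄ with hε
  set α := eulerGaugeα m₂ m₃ with hα
  set β := eulerGaugeβ m₂ m₄ with hβ
  set q := eulerGaugeQ m₁ m₂ m₃ m₄ E (z₂ : ℂ) with hq
  let W : ℝ → ℂ := gaugeW z₂ γ δ ε
  let P : ℝ → ℂ := gaugeP z₂ γ δ ε
  let P' : ℝ → ℂ := gaugeP' z₂ γ δ ε
  let R : ℝ → ℂ := fun z => W z * u z
  let R₁ : ℝ → ℂ := fun z => W z * (P z * u z + u₁ z)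
  let R₂ : ℝ → ℂ := fun z => W z * (u₂ z + 2 * P z * u₁ z + (P z ^ 2 + P' z) * u z)
  refine ⟨R, ⟨⟨R₁, R₂, fun z hz => ?_⟩, ?_, ?_⟩, ?_⟩
  · -- the ODE
    obtain ⟨hz1, hzz⟩ := hz
    obtain ⟨hdu, hdu₁, heq⟩ := hode z ⟨hz1, hzz⟩
    have hW := hasDerivAt_gaugeW (z₂ := z₂) γ δ ε hz1 hzz
    have hP := hasDerivAt_gaugeP (z₂ := z₂) γ δ ε hz1 hzz
    refine ⟨?_, ?_, ?_⟩
    · have hR := hW.mul hdu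
      refine hR.congr_deriv ?_
      simp only [R₁, W, P]
      ring
    · have hin : HasDerivAt (fun x => P x * u x + u₁ x) (P' z * u z + P z * u₁ z + u₂ z) z :=
        (hP.mul hdu).add hdu₁
      have hR₁ := hW.mul hin
      refine hR₁.congr_deriv ?_
      simp only [R₂, W, P, P']
      ring
    · -- lead·R₂ + C·R = W·[(2·lead·P − mid)·u₁ + (lead·(P²+P′) − low + C)·u] + W·(Heun equation)
      have hz0 : (z : ℂ) ≠ 0 := by
        have : (0 : ℝ) < z := by linarith
        exact_mod_cast this.ne'
      have hz1' : (z : ℂ) - 1 ≠ 0 := sub_ne_zero.mpr (by exact_mod_cast (ne_of_gt hz1))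
      have hz2' : (z : ℂ) ≠ (z₂ : ℂ) := by exact_mod_cast (ne_of_lt hzz)
      have hz2'' : (z : ℂ) - z₂ ≠ 0 := sub_ne_zero.mpr hz2'
      have hC := sqcdCoeff_eq_normalForm m₁ m₂ m₃ m₄ E (z₂ : ℂ) (z := z)
        (by intro h0; exact hz0 (by exact_mod_cast h0))
        (by intro h0; exact hz1' (by rw [sub_eq_zero]; exact_mod_cast h0)) hz2'
      have hlead : GeneralHeun.lead (z₂ : ℂ) z ≠ 0 := by
        unfold GeneralHeun.lead
        exact mul_ne_zero (mul_ne_zero hz0 hz1') hz2''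
      have hCeq : sqcdCoeff m₁ m₂ m₃ m₄ E (↑z₂) z =
          GeneralHeun.lead (z₂ : ℂ) z * heunNormalFormQ (↑z₂) α β γ δ ε q z := by
        rw [← hC]; field_simp
      have h1 : 2 * GeneralHeun.lead (z₂ : ℂ) z * P z = GeneralHeun.mid (z₂ : ℂ) γ δ ε z := by
        simp only [P, gaugeP]
        unfold GeneralHeun.lead GeneralHeun.mid
        field_simp
      have h2 : GeneralHeun.lead (z₂ : ℂ) z * (P z ^ 2 + P' z) - GeneralHeun.low α β q z +
          sqcdCoeff m₁ m₂ m₃ m₄ E (↑z₂) z = 0 := by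
        rw [hCeq]
        simp only [P, P', gaugeP, gaugeP']
        unfold heunNormalFormQ GeneralHeun.lead GeneralHeun.low
        field_simp
        ring
      have key : GeneralHeun.lead (z₂ : ℂ) z * R₂ z + sqcdCoeff m₁ m₂ m₃ m₄ E (↑z₂) z * R z =
          W z * ((2 * GeneralHeun.lead (z₂ : ℂ) z * P z - GeneralHeun.mid (z₂ : ℂ) γ δ ε z) * u₁ z
            + (GeneralHeun.lead (z₂ : ℂ) z * (P z ^ 2 + P' z) - GeneralHeun.low α β q z +
                sqcdCoeff m₁ m₂ m₃ m₄ E (↑z₂) z) * u z)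
          + W z * (GeneralHeun.lead (z₂ : ℂ) z * u₂ z + GeneralHeun.mid (z₂ : ℂ) γ δ ε z * u₁ z +
              GeneralHeun.low α β q z * u z) := by
        simp only [R, R₂]
        ring
      rw [key, h1, h2, heq]
      ring
  · -- branch at z = 1: exponent ρ + δ/2
    refine ⟨min e (min (1 / 2) ((z₂ - 1) / 2)), by positivity, fun z =>
      eulerKernel (-(γ / 2)) z * eulerKernel (-(ε / 2)) (z₂ - z) * h z, ?_, ?_⟩
    · have hS0 : ∀ z ∈ Ioo (1 - min e (min (1 / 2) ((z₂ - 1) / 2)))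
          (1 + min e (min (1 / 2) ((z₂ - 1) / 2))), 0 < z := by
        intro z hz; obtain ⟨hzl, -⟩ := hz
        have : min e (min (1 / 2) ((z₂ - 1) / 2)) ≤ 1 / 2 := le_trans (min_le_right _ _) (min_le_left _ _)
        linarith
      have hS2 : ∀ z ∈ Ioo (1 - min e (min (1 / 2) ((z₂ - 1) / 2)))
          (1 + min e (min (1 / 2) ((z₂ - 1) / 2))), 0 < z₂ - z := by
        intro z hz; obtain ⟨-, hzr⟩ := hz
        have : min e (min (1 / 2) ((z₂ - 1) / 2)) ≤ (z₂ - 1) / 2 :=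
          le_trans (min_le_right _ _) (min_le_right _ _)
        linarith
      have hSe : Ioo (1 - min e (min (1 / 2) ((z₂ - 1) / 2))) (1 + min e (min (1 / 2) ((z₂ - 1) / 2)))
          ⊆ Ioo (1 - e) (1 + e) := by
        intro z hz; obtain ⟨hzl, hzr⟩ := hz
        have : min e (min (1 / 2) ((z₂ - 1) / 2)) ≤ e := min_le_left _ _
        exact ⟨by linarith, by linarith⟩
      exact ((contDiffOn_eulerKernel_of_pos _ hS0).mul (contDiffOn_eulerKernel_const_sub _ z₂ hS2)).mul
        (hh.mono hSe)
    · intro z hz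
      obtain ⟨hz1, hzr⟩ := hz
      have hmin : min e (min (1 / 2) ((z₂ - 1) / 2)) ≤ e := min_le_left _ _
      have hz1' : 0 < z - 1 := by linarith
      have hbz := hbr z ⟨hz1, by linarith⟩
      simp only [R, W, gaugeW]
      rw [hbz, ← eulerKernel_neg_mul_cpow (δ / 2) ρ hz1']
      push_cast
      ring
  · -- analytic branch at z₂: exponent ε/2
    refine ⟨min e' ((z₂ - 1) / 2), by positivity, fun z =>
      eulerKernel (-(γ / 2)) z * eulerKernel (-(δ / 2)) (z - 1) * g z, ?_, ?_⟩
    · have hS0 : ∀ z ∈ Ioo (z₂ - min e' ((z₂ - 1) / 2)) (z₂ + min e' ((z₂ - 1) / 2)), 0 < z := by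
        intro z hz; obtain ⟨hzl, -⟩ := hz
        have : min e' ((z₂ - 1) / 2) ≤ (z₂ - 1) / 2 := min_le_right _ _
        linarith
      have hS1 : ∀ z ∈ Ioo (z₂ - min e' ((z₂ - 1) / 2)) (z₂ + min e' ((z₂ - 1) / 2)), 0 < z - 1 := by
        intro z hz; obtain ⟨hzl, -⟩ := hz
        have : min e' ((z₂ - 1) / 2) ≤ (z₂ - 1) / 2 := min_le_right _ _
        linarith
      have hSe : Ioo (z₂ - min e' ((z₂ - 1) / 2)) (z₂ + min e' ((z₂ - 1) / 2)) ⊆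
          Ioo (z₂ - e') (z₂ + e') := by
        intro z hz; obtain ⟨hzl, hzr⟩ := hz
        have : min e' ((z₂ - 1) / 2) ≤ e' := min_le_left _ _
        exact ⟨by linarith, by linarith⟩
      exact ((contDiffOn_eulerKernel_of_pos _ hS0).mul (contDiffOn_eulerKernel_sub _ 1 hS1)).mul
        (hg.mono hSe)
    · intro z hz
      obtain ⟨hzl, hzr⟩ := hz
      have hmin : min e' ((z₂ - 1) / 2) ≤ e' := min_le_left _ _
      have hz2 : 0 < z₂ - z := by linarith
      have hgz := hsm z ⟨by linarith, hzr⟩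
      simp only [R, W, gaugeW]
      rw [hgz, eulerKernel_neg_eq_cpow (ε / 2) hz2]
      push_cast
      ring
  · -- injectivity
    intro hR z hz
    have h0 := hR z hz
    simp only [R] at h0
    rcases mul_eq_zero.mp h0 with hW0 | hu0
    · exact absurd hW0 (gaugeW_ne_zero z₂ γ δ ε z)
    · exact hu0

end RouteW

end Summit.Ventures.KdS
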